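import Summits.MatrixMultiplication.MatrixMultiplication.Theorems.PairwiseCurvedTilingsLC.Negative.GenericSimpleRoots
import Literature.ModelTheory.PseudofiniteFields.EtaleOpenTopologyBasis
import Literature.ModelTheory.PseudofiniteFields.Prop27NormalForm
import Literature.ModelTheory.PseudofiniteFields.DefinableSetsFiniteFieldsDecomposition
import Literature.ModelTheory.PseudofiniteFields.FiniteFieldTheory
import Mathlib.RingTheory.Localization.FractionRing
import Mathlib.RingTheory.Ideal.Maximal
import Mathlib.Algebra.MvPolynomial.Equiv
import Mathlib.Algebra.Polynomial.Derivative

/-!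
# Generic points of a definable set are étale-interior (line LonelyTranslates c1, Prop27Reduction)

Crux stmt-MatrixMultiplication-17883 `PairwiseCurvedTilingsLC`; registered stub `stub_genericInterior`.

Over a pseudo-finite field `K` of CHARACTERISTIC `0`, for a definable `T = φ(K^m; y)` there is a
non-zero `D ∈ K[x_1..x_m]` such that every point of `T` off `D = 0` has a basic étale
neighbourhood inside `T` (this replaces, for the line's lonely-translate argument, the use of the
Walsberg–Ye decomposition of `T`).  Proof: by the CDM Prop. (2.7) normal form
(`ChatzidakisVanDenDriesMacintyre1992_prop27.exists_polynomial_normalForm`, the one remaining named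
fact `h27`) `T = ⋂_l {x | G_l(x, s) = 0 has a root}`; the generic-simple-roots theorem
`stub_relGen` with NO bound coordinates gives `ρ ≠ 0` and `H_l` whose roots are roots of `G_l`,
which have a root whenever `G_l` has one, and whose roots are all simple, at points off `ρ = 0`;
so off `ρ = 0`, `T` is the intersection of the single-root étale images
`{x | H_l(x, ·) has a simple root}` (`exists_etaleDatum_simpleRoot`) with the principal open
`ρ ≠ 0` — a basic étale-open set (`exists_etaleDatum_iInter_inter`).
-/

set_option linter.dupNamespace false

namespace Summit.MatrixMultiplication.MatrixMultiplication.Theorems.PairwiseCurvedTilingsLC.Negative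

open FirstOrder FirstOrder.Language FirstOrder.Ring
open Literature.ModelTheory.PseudofiniteFields
open Polynomial

/-! ### Single-root étale data -/

section RootDatum

variable {K : Type} [Field K] {m : ℕ}

/-- The polynomial `P(x; s)` over `K[x]` placed in `K[x, s]` with `s` the auxiliary variable
`Sum.inr 0`. [folklore] -/
theorem eval_sumElim_eval₂_rename_inl (P : Polynomial (MvPolynomial (Fin m) K))
    (x : Fin m → K) (t : Fin 1 → K) :
    MvPolynomial.eval (Sum.elim x t)
        (P.eval₂ (MvPolynomial.rename (Sum.inl : Fin m → Fin m ⊕ Fin 1)).toRingHom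
          (MvPolynomial.X (Sum.inr 0))) =
      (P.map (MvPolynomial.eval x)).eval (t 0) := by
  rw [Polynomial.hom_eval₂, Polynomial.eval_map]
  congr 1
  · refine MvPolynomial.ringHom_ext (fun a => ?_) (fun i => ?_)
    · simp
    · simp
  · simp

/-- The `s`-derivative of `P(x; s)` placed in `K[x, s]` is `P'(x; s)` placed in `K[x, s]`.
[folklore] -/
theorem pderiv_inr_eval₂_rename_inl (P : Polynomial (MvPolynomial (Fin m) K)) :
    MvPolynomial.pderiv (Sum.inr 0)
        (P.eval₂ (MvPolynomial.rename (Sum.inl : Fin m → Fin m ⊕ Fin 1)).toRingHom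
          (MvPolynomial.X (Sum.inr 0))) =
      (derivative P).eval₂ (MvPolynomial.rename (Sum.inl : Fin m → Fin m ⊕ Fin 1)).toRingHom
          (MvPolynomial.X (Sum.inr 0)) := by
  induction P using Polynomial.induction_on' with
  | add p q hp hq => simp only [Polynomial.eval₂_add, map_add, hp, hq]
  | monomial n a =>
    simp only [Polynomial.eval₂_monomial, derivative_monomial, AlgHom.toRingHom_eq_coe,
      RingHom.coe_coe]
    rw [(MvPolynomial.pderiv (Sum.inr 0)).leibniz, (MvPolynomial.pderiv (Sum.inr 0)).leibniz_pow]
    have h0 : MvPolynomial.pderiv (Sum.inr (0 : Fin 1))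
        (MvPolynomial.rename (Sum.inl : Fin m → Fin m ⊕ Fin 1) a) = 0 :=
      EtaleDatum.pderiv_rename_eq_zero_of_forall_ne (fun _ => Sum.inl_ne_inr) a
    simp only [h0, MvPolynomial.pderiv_X_self, smul_eq_mul, mul_one, map_mul, map_natCast]
    rcases n with _ | n
    · simp
    · simp only [Nat.add_sub_cancel, Nat.cast_add, Nat.cast_one]
      ring

/-- **The single-root étale datum**: `{x | P(x, ·) has a SIMPLE root in K}` is a basic étale-open
set (one auxiliary variable `s`, equation `P(x, s)`, localisation `1`, Jacobian `∂P/∂s`).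
[folklore] -/
theorem exists_etaleDatum_simpleRoot (P : Polynomial (MvPolynomial (Fin m) K)) :
    ∃ E : EtaleDatum K m 1, E.image =
      {x | ∃ s : K, (P.map (MvPolynomial.eval x)).eval s = 0 ∧
        (derivative (P.map (MvPolynomial.eval x))).eval s ≠ 0} := by
  refine ⟨⟨fun _ => P.eval₂ (MvPolynomial.rename (Sum.inl : Fin m → Fin m ⊕ Fin 1)).toRingHom
      (MvPolynomial.X (Sum.inr 0)), 1⟩, ?_⟩
  ext x
  simp only [EtaleDatum.mem_image_iff, Set.mem_setOf_eq, map_one, ne_eq, one_ne_zero,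
    not_false_eq_true, true_and]
  have hjac : (⟨fun _ => P.eval₂ (MvPolynomial.rename (Sum.inl : Fin m → Fin m ⊕ Fin 1)).toRingHom
      (MvPolynomial.X (Sum.inr 0)), 1⟩ : EtaleDatum K m 1).jacobianDet =
      (derivative P).eval₂ (MvPolynomial.rename (Sum.inl : Fin m → Fin m ⊕ Fin 1)).toRingHom
        (MvPolynomial.X (Sum.inr 0)) := by
    rw [EtaleDatum.jacobianDet, Matrix.det_unique]
    simp only [Matrix.of_apply, Fin.default_eq_zero]
    exact pderiv_inr_eval₂_rename_inl P
  constructor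
  · rintro ⟨t, ht, hjt⟩
    refine ⟨t 0, ?_, ?_⟩
    · have := ht 0
      rwa [eval_sumElim_eval₂_rename_inl] at this
    · rw [hjac, eval_sumElim_eval₂_rename_inl, ← Polynomial.derivative_map] at hjt
      exact hjt
  · rintro ⟨s, hs, hds⟩
    refine ⟨fun _ => s, fun _ => ?_, ?_⟩
    · rw [eval_sumElim_eval₂_rename_inl]; exact hs
    · rw [hjac, eval_sumElim_eval₂_rename_inl, ← Polynomial.derivative_map]; exact hds

/-- Finite intersections of basic étale-open sets with a principal open are basic étale-open.
[folklore] -/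
theorem exists_etaleDatum_iInter_inter {L : ℕ} (r : Fin L → ℕ) (E : ∀ l, EtaleDatum K m (r l))
    (ρ : MvPolynomial (Fin m) K) :
    ∃ (r' : ℕ) (E' : EtaleDatum K m r'),
      E'.image = {x | MvPolynomial.eval x ρ ≠ 0} ∩ ⋂ l, (E l).image := by
  classical
  -- induction on the number of sets intersected
  have key : ∀ n : ℕ, ∃ (r' : ℕ) (E' : EtaleDatum K m r'),
      E'.image = {x | MvPolynomial.eval x ρ ≠ 0} ∩ ⋂ (l : Fin L) (_ : (l : ℕ) < n), (E l).image := by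
    intro n
    induction n with
    | zero =>
      obtain ⟨E₀, hE₀⟩ := EtaleDatum.exists_image_eq_setOf_eval_ne_zero (K := K) ρ
      refine ⟨1, E₀, ?_⟩
      rw [hE₀]
      ext x
      simp
    | succ n ih =>
      obtain ⟨r', E', hE'⟩ := ih
      by_cases hn : n < L
      · obtain ⟨E'', hE''⟩ := E'.exists_image_eq_inter (E ⟨n, hn⟩)
        refine ⟨_, E'', ?_⟩
        rw [hE'', hE']
        ext x
        simp only [Set.mem_inter_iff, Set.mem_setOf_eq, Set.mem_iInter]
        constructor
        · rintro ⟨⟨hρ, hall⟩, hn'⟩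
          refine ⟨hρ, fun l hl => ?_⟩
          rcases Nat.lt_succ_iff_lt_or_eq.1 hl with hl | hl
          · exact hall l hl
          · have : l = ⟨n, hn⟩ := Fin.ext hl
            subst this
            exact hn'
        · rintro ⟨hρ, hall⟩
          exact ⟨⟨hρ, fun l hl => hall l (Nat.lt_succ_of_lt hl)⟩, hall ⟨n, hn⟩ (Nat.lt_succ_self n)⟩
      · refine ⟨r', E', ?_⟩
        rw [hE']
        ext x
        simp only [Set.mem_inter_iff, Set.mem_setOf_eq, Set.mem_iInter]
        refine and_congr_right fun _ => forall_congr' fun l => ?_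
        constructor
        · intro h hl; exact h (lt_of_lt_of_le l.2 (not_lt.1 hn))
        · intro h _; exact h (lt_of_lt_of_le (lt_of_lt_of_le l.2 (not_lt.1 hn)) (Nat.le_succ n))
  obtain ⟨r', E', hE'⟩ := key L
  refine ⟨r', E', ?_⟩
  rw [hE']
  ext x
  simp only [Set.mem_inter_iff, Set.mem_setOf_eq, Set.mem_iInter]
  exact and_congr_right fun _ => ⟨fun h l => h l l.2, fun h l _ => h l⟩

end RootDatum

/-! ### The theorem -/

/-- In `F[w]` with NO bound variables (`k = 0`) the zero ideal is maximal (`F[∅] = F` is a field).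
[folklore] -/
theorem span_range_fin_zero_isMaximal {F : Type} [Field F]
    (f : Fin 0 → MvPolynomial (Fin 0) F) : (Ideal.span (Set.range f)).IsMaximal := by
  have hempty : Set.range f = ∅ := Set.range_eq_empty f
  rw [hempty, Ideal.span_empty]
  set e := MvPolynomial.isEmptyAlgEquiv F (Fin 0)
  haveI : (⊥ : Ideal F).IsMaximal := Ideal.bot_isMaximal
  have h := Ideal.comap_isMaximal_of_surjective (e : MvPolynomial (Fin 0) F →+* F) e.surjective
    (K := ⊥)
  rwa [Ideal.comap_bot_of_injective (e : MvPolynomial (Fin 0) F →+* F) e.injective] at h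

/-- **Generic points of a definable set are étale-interior** (registered stub
`stub_genericInterior`; characteristic `0`, from CDM Prop. (2.7) through `stub_prop27NormalForm` and
the generic-simple-roots theorem `stub_relGen` with no bound coordinates). -/
theorem stub_genericInterior (h27 : ChatzidakisVanDenDriesMacintyre1992_prop27)
    (K : Type) [Field K] [CompatibleRing K] [CharZero K] (hK : K ⊨ finiteFieldTheory)
    {m n : ℕ} (φ : Language.ring.Formula (Fin m ⊕ Fin n)) (y : Fin n → K) :
    ∃ D : MvPolynomial (Fin m) K, D ≠ 0 ∧
      ∀ w : Fin m → K, φ.Realize (Sum.elim w y) → MvPolynomial.eval w D ≠ 0 →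
        ∃ (r : ℕ) (E : EtaleDatum K m r), w ∈ E.image ∧
          E.image ⊆ {x | φ.Realize (Sum.elim x y)} := by
  classical
  haveI : Infinite K := Infinite.of_injective (Nat.cast : ℕ → K) Nat.cast_injective
  obtain ⟨L, G, hG⟩ := h27.exists_polynomial_normalForm φ K hK y
  -- move to the ambient `Fin m ⊕ Fin 0` of the generic-simple-roots theorem (no bound coordinates)
  set ι : MvPolynomial (Fin m) K →+* MvPolynomial (Fin m ⊕ Fin 0) K :=
    (MvPolynomial.rename (Sum.inl : Fin m → Fin m ⊕ Fin 0)).toRingHom with hι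
  set π : MvPolynomial (Fin m ⊕ Fin 0) K →+* MvPolynomial (Fin m) K :=
    (MvPolynomial.rename (Sum.elim id Fin.elim0 : Fin m ⊕ Fin 0 → Fin m)).toRingHom with hπ
  have hevalι : ∀ w : Fin m → K, (MvPolynomial.eval (Sum.elim w Fin.elim0)).comp ι =
      MvPolynomial.eval w := by
    intro w
    refine MvPolynomial.ringHom_ext (fun a => by simp [hι]) (fun i => by simp [hι])
  have hevalπ : ∀ w : Fin m → K, (MvPolynomial.eval w).comp π =
      MvPolynomial.eval (Sum.elim w Fin.elim0) := by
    intro w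
    refine MvPolynomial.ringHom_ext (fun a => by simp [hπ]) (fun i => ?_)
    rcases i with i | i
    · simp [hπ]
    · exact i.elim0
  obtain ⟨ρ, hρ0, H, hH⟩ := stub_relGen (K := K) (e := m) (k := 0) (L := L) Fin.elim0
    (span_range_fin_zero_isMaximal _) (fun l => (G l).map ι)
  refine ⟨ρ, hρ0, fun w hw hρw => ?_⟩
  -- the specialised statements at `w`
  have hx : ∀ j : Fin 0, MvPolynomial.eval (Sum.elim w Fin.elim0) ((Fin.elim0 : Fin 0 → _) j) = 0 :=
    fun j => j.elim0
  have hρx : MvPolynomial.eval (Sum.elim w Fin.elim0 ∘ Sum.inl) ρ ≠ 0 := by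
    rwa [Sum.elim_comp_inl]
  -- single-root data for the `H_l` pulled back to `K[x]`
  choose E₁ hE₁ using fun l => exists_etaleDatum_simpleRoot (K := K) ((H l).map π)
  obtain ⟨r, E, hE⟩ := exists_etaleDatum_iInter_inter (fun _ => 1) E₁ ρ
  have hHπ : ∀ (l) (x : Fin m → K), ((H l).map π).map (MvPolynomial.eval x) =
      (H l).map (MvPolynomial.eval (Sum.elim x Fin.elim0)) := by
    intro l x; rw [Polynomial.map_map, hevalπ]
  have hGι : ∀ (l) (x : Fin m → K), ((G l).map ι).map (MvPolynomial.eval (Sum.elim x Fin.elim0)) =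
      (G l).map (MvPolynomial.eval x) := by
    intro l x; rw [Polynomial.map_map, hevalι]
  refine ⟨r, E, ?_, ?_⟩
  · -- `w ∈ E.image`
    rw [hE]
    refine ⟨hρw, Set.mem_iInter.2 fun l => ?_⟩
    rw [hE₁]
    obtain ⟨hR1, hR2, hR3⟩ := hH (Sum.elim w Fin.elim0) hx hρx l
    obtain ⟨s, hs⟩ := (hG w).1 hw l
    obtain ⟨s', hs'⟩ := hR2 ⟨s, by rw [hGι]; exact hs⟩
    refine ⟨s', ?_, ?_⟩
    · rw [hHπ]; exact hs'
    · rw [hHπ]; exact hR3 s' hs'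
  · -- `E.image ⊆ T`
    intro x hxE
    rw [hE] at hxE
    obtain ⟨hρx', hall⟩ := hxE
    refine (hG x).2 fun l => ?_
    have hl := Set.mem_iInter.1 hall l
    rw [hE₁] at hl
    obtain ⟨s, hs, -⟩ := hl
    have hρx'' : MvPolynomial.eval (Sum.elim x Fin.elim0 ∘ Sum.inl) ρ ≠ 0 := by
      rwa [Sum.elim_comp_inl]
    obtain ⟨hR1, -, -⟩ := hH (Sum.elim x Fin.elim0) (fun j => j.elim0) hρx'' l
    refine ⟨s, ?_⟩
    rw [← hGι]
    exact hR1 s (by rw [← hHπ]; exact hs)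

end Summit.MatrixMultiplication.MatrixMultiplication.Theorems.PairwiseCurvedTilingsLC.Negative
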